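import Literature.Topology.FourManifolds.HandleFeetOrientation
import HarnessLib

/-!
# Reflecting a Morse chart of index `1`: a chart with the two feet exchanged

Topic `Literature/Topology/FourManifolds` (fact seat
`provefact-Literature.Topology.FourManifolds.IsHandlebody.exists_diffeomorph_isBoundaryGluing_sphere`,
step F2b₁ of the Lickorish–Wallace DAG; level step H2 of the reduction of L1
`oneHandle_nonempty_diffeomorph`, see `HandleAttachmentNormalisation.lean` and
`HandleFeetOrientation.lean`).  Everything here is **proved**; no named facts.

Let `φ` be a chart of the manifold with boundary `M` (model `𝓡∂ (n + 1)`) in the maximal atlas,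
`p ∈ φ.source`, in which `f` has Milnor's normal form of index `1`,
`f q = f p + Q₁(φ̂ q - φ̂ p)` (`φ̂ = φ.extend`), and let the closed ball of radius `R₀` about
`c₀ = φ̂ p` lie in the target of `φ̂`.  Composing `φ̂` with the **reflection**
`u ↦ c₀ + r(u - c₀)`, `r(u₀, y) = (-u₀, y)` (`OneHandleModel.reflE`,
`HandleFeetOrientation.lean`), which maps the ball `B(c₀, R₀)` onto itself and preserves `Q₁`
(`OneHandleModel.milnorQuadratic_one_reflE`), gives a new chart `reflectChart φ p R₀` on
`φ.source ∩ φ̂⁻¹ B(c₀, R₀)` (an `OpenPartialHomeomorph` into the model half-space; the reflected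
ball stays in the half-space because the ball lies in the range of the model), which is again in
the maximal atlas (Mathlib's `OpenPartialHomeomorph.mem_maximalAtlas_of_contMDiffOn`: both the
chart and its inverse are smooth, being composites of `φ`, the affine reflection and the model
maps), contains `p` with the same centre `c₀`, has the same normal form for `f`
(`apply_eq_reflectChart`), and whose **feet are the feet of `φ` with the sign exchanged**:
`φ̂ᵣ⁻¹(c₀ + footModel s m ρ w) = φ̂⁻¹(c₀ + footModel (-s) m ρ w)` (`reflectChart_foot`).  This
is the chart-level form of the symmetry `(u₀, y) ↦ (-u₀, y)` of the `1`-handle model used to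
exchange the rôles of the two attaching discs (Kosinski (1993), VI §6, proof of (6.6); Milnor
(1965), proof of Thm. 3.13).

## References

* A. A. Kosinski, *Differential Manifolds* (1993), VI (6.6). [Kosinski1993]
* J. Milnor, *Lectures on the h-cobordism theorem* (1965), Def. 3.1, proof of Thm. 3.13.
  [MilnorHCobordism1965]
* J. M. Lee, *Introduction to Smooth Manifolds*, 2nd ed. (2013), Prop. 1.17, Thm. 5.11.
  [LeeSmoothManifolds2013]
-/

open scoped Manifold ContDiff Topology
open Set Function Module Metric

noncomputable section

namespace Literature.Topology.FourManifolds

universe u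

/-- Local notation: `𝔼 n` is the model Euclidean space `EuclideanSpace ℝ (Fin n)`. -/
local notation "𝔼 " n:arg => EuclideanSpace ℝ (Fin n)
/-- Local notation: `ℍ n` is the model half-space `EuclideanHalfSpace n`. -/
local notation "ℍ " n:arg => EuclideanHalfSpace n

namespace MorseChartReflect

variable {n : ℕ}

/-! ### The affine reflection about a centre -/

/-- **The reflection about `c₀` in the first coordinate**, `u ↦ c₀ + r(u - c₀)`. [folklore] -/
def reflAt (c₀ : 𝔼 (n + 1)) (u : 𝔼 (n + 1)) : 𝔼 (n + 1) := c₀ + OneHandleModel.reflE n (u - c₀)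

variable (c₀ : 𝔼 (n + 1))

/-- The reflection is an involution. [folklore] -/
@[simp] theorem reflAt_reflAt (u : 𝔼 (n + 1)) : reflAt c₀ (reflAt c₀ u) = u := by
  simp [reflAt, OneHandleModel.reflE_reflE]

/-- The reflection fixes the centre. [folklore] -/
@[simp] theorem reflAt_self : reflAt c₀ c₀ = c₀ := by simp [reflAt]

/-- The reflection is smooth (affine). [folklore] -/
theorem contDiff_reflAt : ContDiff ℝ ∞ (reflAt (n := n) c₀) :=
  contDiff_const.add ((OneHandleModel.reflE n).contDiff.comp (contDiff_id.sub contDiff_const))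

/-- The reflection is continuous. [folklore] -/
theorem continuous_reflAt : Continuous (reflAt (n := n) c₀) := (contDiff_reflAt c₀).continuous

/-- The reflection preserves distances to the centre. [folklore] -/
theorem norm_reflAt_sub (u : 𝔼 (n + 1)) : ‖reflAt c₀ u - c₀‖ = ‖u - c₀‖ := by
  show ‖c₀ + OneHandleModel.reflE n (u - c₀) - c₀‖ = ‖u - c₀‖
  rw [add_sub_cancel_left, OneHandleModel.norm_reflE]

/-- The reflection maps balls about the centre to themselves. [folklore] -/
theorem reflAt_mem_ball {R₀ : ℝ} {u : 𝔼 (n + 1)} (hu : u ∈ ball c₀ R₀) : reflAt c₀ u ∈ ball c₀ R₀ := by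
  rw [mem_ball, dist_eq_norm] at hu ⊢; rwa [norm_reflAt_sub]

/-- Differences of reflected points are reflected differences. [folklore] -/
theorem reflAt_sub_reflAt (u v : 𝔼 (n + 1)) :
    reflAt c₀ u - reflAt c₀ v = OneHandleModel.reflE n (u - v) := by
  simp only [reflAt, add_sub_add_left_eq_sub, ← map_sub, sub_sub_sub_cancel_right]

/-- The reflection sends `c₀ + footModel s` to `c₀ + footModel (-s)`. [folklore] -/
theorem reflAt_add_footModel (s m ρ : ℝ) (w : 𝔼 n) :
    reflAt c₀ (c₀ + footModel n s m ρ w) = c₀ + footModel n (-s) m ρ w := by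
  simp [reflAt, OneHandleModel.reflE_footModel]

/-! ### The reflected chart -/

variable {M : Type u} [TopologicalSpace M] (φ : OpenPartialHomeomorph M (ℍ (n + 1))) (p : M) (R₀ : ℝ)

/-- The range of the model with boundary contains the closed chart balls lying in a chart target.
[folklore] -/
theorem ball_subset_range (hball : closedBall (φ.extend (𝓡∂ (n + 1)) p) R₀ ⊆ (φ.extend (𝓡∂ (n + 1))).target) :
    ball (φ.extend (𝓡∂ (n + 1)) p) R₀ ⊆ range (𝓡∂ (n + 1)) :=
  (ball_subset_closedBall.trans hball).trans (OpenPartialHomeomorph.extend_target_subset_range _)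

/-- The reflected chart as a function, `I⁻¹ ∘ reflAt (φ̂ p) ∘ φ̂`. [folklore] -/
def rcFun (q : M) : ℍ (n + 1) :=
  (𝓡∂ (n + 1)).symm (reflAt (φ.extend (𝓡∂ (n + 1)) p) (φ.extend (𝓡∂ (n + 1)) q))

/-- The inverse of the reflected chart as a function, `φ̂⁻¹ ∘ reflAt (φ̂ p) ∘ I`. [folklore] -/
def rcInv (x : ℍ (n + 1)) : M :=
  (φ.extend (𝓡∂ (n + 1))).symm (reflAt (φ.extend (𝓡∂ (n + 1)) p) ((𝓡∂ (n + 1)) x))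

/-- `I ∘ rcFun = reflAt ∘ φ̂` on the chart ball. [folklore] -/
theorem apply_rcFun (hball : closedBall (φ.extend (𝓡∂ (n + 1)) p) R₀ ⊆ (φ.extend (𝓡∂ (n + 1))).target)
    {q : M} (hq : φ.extend (𝓡∂ (n + 1)) q ∈ ball (φ.extend (𝓡∂ (n + 1)) p) R₀) :
    (𝓡∂ (n + 1)) (rcFun φ p q) = reflAt (φ.extend (𝓡∂ (n + 1)) p) (φ.extend (𝓡∂ (n + 1)) q) :=
  (𝓡∂ (n + 1)).right_inv (ball_subset_range φ p R₀ hball (reflAt_mem_ball _ hq))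

/-- `φ̂ ∘ rcInv = reflAt ∘ I` on the chart ball, and `rcInv` lands in the source. [folklore] -/
theorem apply_rcInv (hball : closedBall (φ.extend (𝓡∂ (n + 1)) p) R₀ ⊆ (φ.extend (𝓡∂ (n + 1))).target)
    {x : ℍ (n + 1)} (hx : (𝓡∂ (n + 1)) x ∈ ball (φ.extend (𝓡∂ (n + 1)) p) R₀) :
    rcInv φ p x ∈ φ.source ∧
      φ.extend (𝓡∂ (n + 1)) (rcInv φ p x) = reflAt (φ.extend (𝓡∂ (n + 1)) p) ((𝓡∂ (n + 1)) x) := by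
  have htgt : reflAt (φ.extend (𝓡∂ (n + 1)) p) ((𝓡∂ (n + 1)) x) ∈ (φ.extend (𝓡∂ (n + 1))).target :=
    hball (ball_subset_closedBall (reflAt_mem_ball _ hx))
  refine ⟨?_, (φ.extend (𝓡∂ (n + 1))).right_inv htgt⟩
  have := (φ.extend (𝓡∂ (n + 1))).map_target htgt
  rwa [φ.extend_source] at this

/-- **The reflected chart** `φᵣ = I⁻¹ ∘ reflAt (φ̂ p) ∘ φ̂` on `φ.source ∩ φ̂⁻¹ B(φ̂ p, R₀)`.
[cite: Kosinski1993, VI (6.6)] -/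
def reflectChart (hball : closedBall (φ.extend (𝓡∂ (n + 1)) p) R₀ ⊆ (φ.extend (𝓡∂ (n + 1))).target) :
    OpenPartialHomeomorph M (ℍ (n + 1)) where
  toFun := rcFun φ p
  invFun := rcInv φ p
  source := φ.source ∩ φ.extend (𝓡∂ (n + 1)) ⁻¹' ball (φ.extend (𝓡∂ (n + 1)) p) R₀
  target := (𝓡∂ (n + 1)) ⁻¹' ball (φ.extend (𝓡∂ (n + 1)) p) R₀
  map_source' := by
    rintro q ⟨_, hqb⟩
    show (𝓡∂ (n + 1)) (rcFun φ p q) ∈ ball (φ.extend (𝓡∂ (n + 1)) p) R₀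
    rw [apply_rcFun φ p R₀ hball hqb]
    exact reflAt_mem_ball _ hqb
  map_target' := by
    intro x hx
    have hx' : (𝓡∂ (n + 1)) x ∈ ball (φ.extend (𝓡∂ (n + 1)) p) R₀ := hx
    obtain ⟨hsrc, happ⟩ := apply_rcInv φ p R₀ hball hx'
    refine ⟨hsrc, ?_⟩
    show φ.extend (𝓡∂ (n + 1)) (rcInv φ p x) ∈ ball (φ.extend (𝓡∂ (n + 1)) p) R₀
    rw [happ]
    exact reflAt_mem_ball _ hx'
  left_inv' := by
    rintro q ⟨hq, hqb⟩
    show (φ.extend (𝓡∂ (n + 1))).symm (reflAt (φ.extend (𝓡∂ (n + 1)) p) ((𝓡∂ (n + 1)) (rcFun φ p q))) = q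
    rw [apply_rcFun φ p R₀ hball hqb, reflAt_reflAt]
    exact (φ.extend (𝓡∂ (n + 1))).left_inv (show q ∈ (φ.extend (𝓡∂ (n + 1))).source by
      rwa [φ.extend_source])
  right_inv' := by
    intro x hx
    have hx' : (𝓡∂ (n + 1)) x ∈ ball (φ.extend (𝓡∂ (n + 1)) p) R₀ := hx
    obtain ⟨_, happ⟩ := apply_rcInv φ p R₀ hball hx'
    show (𝓡∂ (n + 1)).symm (reflAt (φ.extend (𝓡∂ (n + 1)) p) (φ.extend (𝓡∂ (n + 1)) (rcInv φ p x))) = x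
    rw [happ, reflAt_reflAt, (𝓡∂ (n + 1)).left_inv]
  open_source := by
    have hc : ContinuousOn (φ.extend (𝓡∂ (n + 1))) φ.source := by
      have h := φ.continuousOn_extend (I := 𝓡∂ (n + 1)); rwa [φ.extend_source] at h
    exact hc.isOpen_inter_preimage φ.open_source isOpen_ball
  open_target := isOpen_ball.preimage (𝓡∂ (n + 1)).continuous
  continuousOn_toFun := by
    have hc : ContinuousOn (φ.extend (𝓡∂ (n + 1))) φ.source := by
      have h := φ.continuousOn_extend (I := 𝓡∂ (n + 1)); rwa [φ.extend_source] at h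
    exact (𝓡∂ (n + 1)).continuous_symm.comp_continuousOn
      ((continuous_reflAt _).comp_continuousOn (hc.mono inter_subset_left))
  continuousOn_invFun := by
    have h1 : Continuous fun x : ℍ (n + 1) => reflAt (φ.extend (𝓡∂ (n + 1)) p) ((𝓡∂ (n + 1)) x) :=
      (continuous_reflAt _).comp (𝓡∂ (n + 1)).continuous
    have h2 : ContinuousOn (φ.extend (𝓡∂ (n + 1))).symm (φ.extend (𝓡∂ (n + 1))).target :=
      φ.continuousOn_extend_symm (I := 𝓡∂ (n + 1))
    refine h2.comp h1.continuousOn fun x hx => ?_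
    exact hball (ball_subset_closedBall (reflAt_mem_ball _ hx))

variable (hball : closedBall (φ.extend (𝓡∂ (n + 1)) p) R₀ ⊆ (φ.extend (𝓡∂ (n + 1))).target)

/-- The source of the reflected chart. [folklore] -/
@[simp] theorem reflectChart_source :
    (reflectChart φ p R₀ hball).source = φ.source ∩ φ.extend (𝓡∂ (n + 1)) ⁻¹' ball (φ.extend (𝓡∂ (n + 1)) p) R₀ :=
  rfl

/-- The target of the reflected chart. [folklore] -/
@[simp] theorem reflectChart_target :
    (reflectChart φ p R₀ hball).target = (𝓡∂ (n + 1)) ⁻¹' ball (φ.extend (𝓡∂ (n + 1)) p) R₀ :=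
  rfl

/-- The reflected chart as a function. [folklore] -/
theorem reflectChart_apply (q : M) : reflectChart φ p R₀ hball q = rcFun φ p q := rfl

/-- The inverse of the reflected chart as a function. [folklore] -/
theorem reflectChart_symm_apply (x : ℍ (n + 1)) : (reflectChart φ p R₀ hball).symm x = rcInv φ p x := rfl

/-- **The extended reflected chart is the reflected extended chart** on its source.
[folklore] -/
theorem extend_reflectChart {q : M} (hq : q ∈ (reflectChart φ p R₀ hball).source) :
    (reflectChart φ p R₀ hball).extend (𝓡∂ (n + 1)) q =
      reflAt (φ.extend (𝓡∂ (n + 1)) p) (φ.extend (𝓡∂ (n + 1)) q) := by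
  rw [OpenPartialHomeomorph.extend_coe, comp_apply, reflectChart_apply]
  exact apply_rcFun φ p R₀ hball hq.2

/-- The centre lies in the source of the reflected chart (`0 < R₀`). [folklore] -/
theorem mem_reflectChart_source (hp : p ∈ φ.source) (hR₀ : 0 < R₀) : p ∈ (reflectChart φ p R₀ hball).source :=
  ⟨hp, mem_ball_self hR₀⟩

/-- **The reflected chart has the same centre.** [folklore] -/
theorem extend_reflectChart_self (hp : p ∈ φ.source) (hR₀ : 0 < R₀) :
    (reflectChart φ p R₀ hball).extend (𝓡∂ (n + 1)) p = φ.extend (𝓡∂ (n + 1)) p := by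
  rw [extend_reflectChart φ p R₀ hball (mem_reflectChart_source φ p R₀ hball hp hR₀), reflAt_self]

/-- **Milnor's normal form of index `1` is preserved by the reflection.**
[cite: MilnorHCobordism1965, Def. 3.1] -/
theorem apply_eq_reflectChart {f : M → ℝ} (hp : p ∈ φ.source) (hR₀ : 0 < R₀)
    (hfq : ∀ q ∈ φ.source, f q = f p + milnorQuadratic 1 (φ.extend (𝓡∂ (n + 1)) q - φ.extend (𝓡∂ (n + 1)) p))
    {q : M} (hq : q ∈ (reflectChart φ p R₀ hball).source) :
    f q = f p + milnorQuadratic 1 ((reflectChart φ p R₀ hball).extend (𝓡∂ (n + 1)) q -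
      (reflectChart φ p R₀ hball).extend (𝓡∂ (n + 1)) p) := by
  rw [extend_reflectChart φ p R₀ hball hq, extend_reflectChart φ p R₀ hball
    (mem_reflectChart_source φ p R₀ hball hp hR₀), reflAt_sub_reflAt,
    OneHandleModel.milnorQuadratic_one_reflE]
  exact hfq q hq.1

/-- **The reflected chart lies in the maximal atlas** (it and its inverse are smooth:
composites of `φ̂`, the affine reflection and the model maps). [cite: LeeSmoothManifolds2013, Prop. 1.17] -/
theorem reflectChart_mem_maximalAtlas [ChartedSpace (ℍ (n + 1)) M] [IsManifold (𝓡∂ (n + 1)) ∞ M]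
    (hφ : φ ∈ IsManifold.maximalAtlas (𝓡∂ (n + 1)) ∞ M) :
    reflectChart φ p R₀ hball ∈ IsManifold.maximalAtlas (𝓡∂ (n + 1)) ∞ M := by
  set c₀ := φ.extend (𝓡∂ (n + 1)) p with hc₀
  apply OpenPartialHomeomorph.mem_maximalAtlas_of_contMDiffOn
  · -- `φᵣ = I⁻¹ ∘ reflAt ∘ φ̂` on the source
    have h1 : ContMDiffOn (𝓡∂ (n + 1)) 𝓘(ℝ, 𝔼 (n + 1)) ∞ (φ.extend (𝓡∂ (n + 1))) φ.source :=
      OpenPartialHomeomorph.contMDiffOn_extend hφ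
    have h2 : ContMDiffOn (𝓡∂ (n + 1)) 𝓘(ℝ, 𝔼 (n + 1)) ∞
        (fun q => reflAt c₀ (φ.extend (𝓡∂ (n + 1)) q)) (reflectChart φ p R₀ hball).source :=
      ((contDiff_reflAt c₀).contMDiff.comp_contMDiffOn h1).mono inter_subset_left
    have h3 := (𝓡∂ (n + 1)).contMDiffOn_symm (n := ∞)
    exact h3.comp h2 fun q hq => ball_subset_range φ p R₀ hball (reflAt_mem_ball _ hq.2)
  · -- `φᵣ⁻¹ = φ̂⁻¹ ∘ reflAt ∘ I = φ⁻¹ ∘ (I⁻¹ ∘ reflAt ∘ I)` on the target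
    have h1 : ContMDiff (𝓡∂ (n + 1)) 𝓘(ℝ, 𝔼 (n + 1)) ∞ fun x : ℍ (n + 1) => reflAt c₀ ((𝓡∂ (n + 1)) x) :=
      (contDiff_reflAt c₀).contMDiff.comp (𝓡∂ (n + 1)).contMDiff
    have h2 : ContMDiffOn (𝓡∂ (n + 1)) (𝓡∂ (n + 1)) ∞
        (fun x : ℍ (n + 1) => (𝓡∂ (n + 1)).symm (reflAt c₀ ((𝓡∂ (n + 1)) x)))
        (reflectChart φ p R₀ hball).target :=
      ((𝓡∂ (n + 1)).contMDiffOn_symm (n := ∞)).comp h1.contMDiffOn fun x hx =>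
        ball_subset_range φ p R₀ hball (reflAt_mem_ball _ hx)
    have h3 : ContMDiffOn (𝓡∂ (n + 1)) (𝓡∂ (n + 1)) ∞ φ.symm φ.target :=
      contMDiffOn_symm_of_mem_maximalAtlas hφ
    have h4 := h3.comp h2 fun x hx => by
      have hx' : reflAt c₀ ((𝓡∂ (n + 1)) x) ∈ ball c₀ R₀ := reflAt_mem_ball _ hx
      have htgt := hball (ball_subset_closedBall hx')
      rw [φ.extend_target] at htgt
      exact htgt.1
    exact h4.congr fun x _ => rfl

/-- A smaller closed ball lies in the target of the extended reflected chart. [folklore] -/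
theorem closedBall_subset_reflectChart_target {R : ℝ} (hR : R < R₀) :
    closedBall (φ.extend (𝓡∂ (n + 1)) p) R ⊆ ((reflectChart φ p R₀ hball).extend (𝓡∂ (n + 1))).target := by
  intro u hu
  have hub : u ∈ ball (φ.extend (𝓡∂ (n + 1)) p) R₀ := closedBall_subset_ball hR hu
  have hur : u ∈ range (𝓡∂ (n + 1)) := ball_subset_range φ p R₀ hball hub
  rw [OpenPartialHomeomorph.extend_target]
  refine ⟨?_, hur⟩
  show (𝓡∂ (n + 1)) ((𝓡∂ (n + 1)).symm u) ∈ ball (φ.extend (𝓡∂ (n + 1)) p) R₀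
  rwa [(𝓡∂ (n + 1)).right_inv hur]

/-- **The feet of the reflected chart are the feet of `φ` with the sign exchanged**:
`φ̂ᵣ⁻¹(c₀ + footModel s m ρ w) = φ̂⁻¹(c₀ + footModel (-s) m ρ w)` (for foot points in the chart
ball). [cite: Kosinski1993, VI (6.6)] -/
theorem reflectChart_extend_symm_add_footModel {s m ρ : ℝ} {w : 𝔼 n}
    (hw : φ.extend (𝓡∂ (n + 1)) p + footModel n s m ρ w ∈ ball (φ.extend (𝓡∂ (n + 1)) p) R₀) :
    ((reflectChart φ p R₀ hball).extend (𝓡∂ (n + 1))).symm (φ.extend (𝓡∂ (n + 1)) p + footModel n s m ρ w) =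
      (φ.extend (𝓡∂ (n + 1))).symm (φ.extend (𝓡∂ (n + 1)) p + footModel n (-s) m ρ w) := by
  rw [OpenPartialHomeomorph.extend_coe_symm, comp_apply, reflectChart_symm_apply, rcInv,
    (𝓡∂ (n + 1)).right_inv (ball_subset_range φ p R₀ hball hw), reflAt_add_footModel]

/-- Points of the chart ball lie in the target of the extended reflected chart. [folklore] -/
theorem mem_reflectChart_extend_target {u : 𝔼 (n + 1)} (hu : u ∈ ball (φ.extend (𝓡∂ (n + 1)) p) R₀) :
    u ∈ ((reflectChart φ p R₀ hball).extend (𝓡∂ (n + 1))).target := by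
  have hur : u ∈ range (𝓡∂ (n + 1)) := ball_subset_range φ p R₀ hball hu
  rw [OpenPartialHomeomorph.extend_target]
  refine ⟨?_, hur⟩
  show (𝓡∂ (n + 1)) ((𝓡∂ (n + 1)).symm u) ∈ ball (φ.extend (𝓡∂ (n + 1)) p) R₀
  rwa [(𝓡∂ (n + 1)).right_inv hur]

omit [TopologicalSpace M] in
/-- Inverses of partial equivalences that agree as functions, with nested sources, agree on the
common target. [folklore] -/
theorem symm_eq_symm_of_forall_eq {e₁ e₂ : PartialEquiv M (𝔼 (n + 1))} (h : ∀ q, e₁ q = e₂ q)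
    (hs : e₁.source ⊆ e₂.source) {u : 𝔼 (n + 1)} (hu₁ : u ∈ e₁.target) (hu₂ : u ∈ e₂.target) :
    e₁.symm u = e₂.symm u := by
  have h1 : e₂ (e₁.symm u) = u := by rw [← h, e₁.right_inv hu₁]
  have h2 : e₂ (e₂.symm u) = u := e₂.right_inv hu₂
  exact e₂.injOn (hs (e₁.map_target hu₁)) (e₂.map_target hu₂) (h1.trans h2.symm)

/-- **The feet of a handle chart built on the reflected chart** are the feet, with the sign
exchanged, of a handle chart built on `φ`, whenever the two handle charts extend to `φ̂ᵣ`, `φ̂`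
with smaller sources (as the charts produced by `exists_handleSide_data` do) and the two foot
points lie in the chart balls. [cite: Kosinski1993, VI (6.6)] -/
theorem foot_eq_foot_neg [ChartedSpace (ℍ (n + 1)) M] {f : M → ℝ} {X X' : Π x : M, TangentSpace (𝓡∂ (n + 1)) x}
    (D : HandleChart (𝓡∂ (n + 1)) f X p) (D' : HandleChart (𝓡∂ (n + 1)) f X' p)
    (hD : ∀ q, D.chart.extend (𝓡∂ (n + 1)) q = (reflectChart φ p R₀ hball).extend (𝓡∂ (n + 1)) q)
    (hDs : D.chart.source ⊆ (reflectChart φ p R₀ hball).source)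
    (hD' : ∀ q, D'.chart.extend (𝓡∂ (n + 1)) q = φ.extend (𝓡∂ (n + 1)) q)
    (hD's : D'.chart.source ⊆ φ.source)
    (hp : p ∈ φ.source) (hR₀ : 0 < R₀) {s m ρ : ℝ} {w : 𝔼 n}
    (hw : φ.extend (𝓡∂ (n + 1)) p + footModel n s m ρ w ∈ ball (φ.extend (𝓡∂ (n + 1)) p) R₀)
    (hw' : φ.extend (𝓡∂ (n + 1)) p + footModel n (-s) m ρ w ∈ ball (φ.extend (𝓡∂ (n + 1)) p) R₀)
    (hwD : φ.extend (𝓡∂ (n + 1)) p + footModel n s m ρ w ∈ (D.chart.extend (𝓡∂ (n + 1))).target)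
    (hwD' : φ.extend (𝓡∂ (n + 1)) p + footModel n (-s) m ρ w ∈ (D'.chart.extend (𝓡∂ (n + 1))).target) :
    D.foot s m ρ w = D'.foot (-s) m ρ w := by
  have hc : D.chart.extend (𝓡∂ (n + 1)) p = φ.extend (𝓡∂ (n + 1)) p := by
    rw [hD, extend_reflectChart_self φ p R₀ hball hp hR₀]
  have hc' : D'.chart.extend (𝓡∂ (n + 1)) p = φ.extend (𝓡∂ (n + 1)) p := hD' p
  have hs₁ : (D.chart.extend (𝓡∂ (n + 1))).source ⊆ ((reflectChart φ p R₀ hball).extend (𝓡∂ (n + 1))).source := by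
    rw [OpenPartialHomeomorph.extend_source, OpenPartialHomeomorph.extend_source]; exact hDs
  have hs₂ : (D'.chart.extend (𝓡∂ (n + 1))).source ⊆ (φ.extend (𝓡∂ (n + 1))).source := by
    rw [OpenPartialHomeomorph.extend_source, OpenPartialHomeomorph.extend_source]; exact hD's
  show (D.chart.extend (𝓡∂ (n + 1))).symm (D.chart.extend (𝓡∂ (n + 1)) p + footModel n s m ρ w) =
    (D'.chart.extend (𝓡∂ (n + 1))).symm (D'.chart.extend (𝓡∂ (n + 1)) p + footModel n (-s) m ρ w)
  rw [hc, hc', symm_eq_symm_of_forall_eq hD hs₁ hwD (mem_reflectChart_extend_target φ p R₀ hball hw),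
    reflectChart_extend_symm_add_footModel φ p R₀ hball hw,
    symm_eq_symm_of_forall_eq hD' hs₂ hwD' (hball (ball_subset_closedBall hw'))]

end MorseChartReflect

end Literature.Topology.FourManifolds
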